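import Summits.Parity.GeneralizedHardyLittlewood.Theorems.PrimeLevelFamEdgeMomentsBeyondDiagonalDiagCornerAbelBV
import HarnessLib

/-!
# Route `PrimeLevelFamEdge`, crux K_A `MomentsBeyondDiagonal` (stmt-Parity-20007), line «petersson_layers» v4, stub `stub_diag`:
# **Abel summation against `f·h` (`f` antitone, `h` of bounded variation) WITHOUT the vanishing condition `f(w+1) = 0`**

`…DiagCornerAbelBV.abs_sum_Ioc_mul_prod_le_of_bv` (p820176) assumes `f(w+1) = 0` (the truncated logarithm `ℓ⁺(k)^m`, `m ≥ 1`,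
vanishes past `Y`). In the general-`Q` corner the decorations `A_ν^{i−a}` also produce the exponent `m = 0` (`f ≡ 1`), where the
boundary term of the Abel identity survives; this file keeps it:

* `abs_sum_Ioc_mul_prod_le_of_bv'` — with `|A(e) − A(u)| ≤ B` on `(u,w]`, `f ≥ 0` antitone `≤ F`, `|h| ≤ H` on `(u,w+1]`,
  `Σ_{u<e≤w}|h(e+1)−h(e)| ≤ V`: **`|Σ_{u<e≤w} a(e)f(e)h(e)| ≤ B·F·(2H + V)`**.

Def-free; theorems only. Helper `--supports stmt-Parity-20007`; closes nothing; K_A, K_B and the Parity summit are NOT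
proved; nothing about Landau–Siegel zeros.

## References
* E. Kowalski, P. Michel, J. VanderKam, J. reine angew. Math. 526 (2000), Prop. 5.1 p. 18.
  [cite: KowalskiMichelVanderKam2000, Prop. 5.1 — derivation (summation by parts in the corner of the diagonal)]
-/

noncomputable section

open Finset Real

namespace Summit.Parity.GeneralizedHardyLittlewood.Theorems.MomentsBeyondDiagonal.DiagCorner

open Summit.Parity.GeneralizedHardyLittlewood.Theorems.BeyondDiagonalBeatsQuarter.KernelFormXSq
  (sum_Ioc_sub_succ sum_Ioc_mul_eq_abel)

/-- **Abel bound against `f·h`, `h` of bounded variation, boundary term kept.** If `|A(e) − A(u)| ≤ B` for `u < e ≤ w`,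
`f ≥ 0` antitone with `f ≤ F`, `|h| ≤ H` on `(u, w+1]` and `Σ_{u<e≤w}|h(e+1)−h(e)| ≤ V`, then
`|Σ_{u<e≤w} a(e)f(e)h(e)| ≤ B·F·(2H+V)`. [folklore] -/
theorem abs_sum_Ioc_mul_prod_le_of_bv' (a : ℕ → ℝ) {f h : ℕ → ℝ} {u w : ℕ} (huw : u ≤ w) {B F H V : ℝ}
    (hB0 : 0 ≤ B) (hB : ∀ e, u < e → e ≤ w → |∑ k ∈ Icc 1 e, a k - ∑ k ∈ Icc 1 u, a k| ≤ B)
    (hf0 : ∀ e, 0 ≤ f e) (hfF : ∀ e, f e ≤ F) (hf : ∀ e, u < e → f (e + 1) ≤ f e)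
    (hhH : ∀ e, u < e → e ≤ w + 1 → |h e| ≤ H) (hV : ∑ e ∈ Ioc u w, |h (e + 1) - h e| ≤ V) :
    |∑ e ∈ Ioc u w, a e * (f e * h e)| ≤ B * (F * (2 * H + V)) := by
  have hF : 0 ≤ F := (hf0 0).trans (hfF 0)
  have hH : 0 ≤ H := (abs_nonneg _).trans (hhH (u + 1) (Nat.lt_succ_self u) (by omega))
  set φ : ℕ → ℝ := fun e ↦ f e * h e with hφ
  set A : ℕ → ℝ := fun e ↦ ∑ k ∈ Icc 1 e, a k with hAdef
  have habel := sum_Ioc_mul_eq_abel a φ huw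
  -- centre at `A u`: `Σ aφ = Σ (A e − A u)(φ e − φ (e+1)) + (A w − A u) φ (w+1)`
  have hcentre : ∑ e ∈ Ioc u w, A u * (φ e - φ (e + 1)) = A u * (φ (u + 1) - φ (w + 1)) := by
    rw [← Finset.mul_sum, sum_Ioc_sub_succ φ huw]
  have hmain : ∑ e ∈ Ioc u w, a e * φ e =
      ∑ e ∈ Ioc u w, (A e - A u) * (φ e - φ (e + 1)) + (A w - A u) * φ (w + 1) := by
    rw [habel]
    have : ∑ e ∈ Ioc u w, (A e - A u) * (φ e - φ (e + 1)) =
        ∑ e ∈ Ioc u w, A e * (φ e - φ (e + 1)) - ∑ e ∈ Ioc u w, A u * (φ e - φ (e + 1)) := by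
      rw [← Finset.sum_sub_distrib]
      exact Finset.sum_congr rfl fun e _ ↦ by ring
    rw [this, hcentre]
    ring
  rw [hmain]
  -- the boundary term
  have hbdry : |(A w - A u) * φ (w + 1)| ≤ B * (F * H) := by
    rcases eq_or_lt_of_le huw with h | h
    · rw [h, sub_self, zero_mul, abs_zero]; positivity
    · rw [abs_mul, hφ]
      simp only
      rw [abs_mul, abs_of_nonneg (hf0 _)]
      exact mul_le_mul (hB w h le_rfl) (mul_le_mul (hfF _) (hhH (w + 1) (by omega) le_rfl) (abs_nonneg _) hF)
        (mul_nonneg (hf0 _) (abs_nonneg _)) hB0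
  calc |∑ e ∈ Ioc u w, (A e - A u) * (φ e - φ (e + 1)) + (A w - A u) * φ (w + 1)|
      ≤ |∑ e ∈ Ioc u w, (A e - A u) * (φ e - φ (e + 1))| + |(A w - A u) * φ (w + 1)| := abs_add_le _ _
    _ ≤ B * (F * (H + V)) + B * (F * H) := by
        refine add_le_add ?_ hbdry
        calc |∑ e ∈ Ioc u w, (A e - A u) * (φ e - φ (e + 1))|
            ≤ ∑ e ∈ Ioc u w, |(A e - A u) * (φ e - φ (e + 1))| := Finset.abs_sum_le_sum_abs _ _
          _ ≤ ∑ e ∈ Ioc u w, B * |φ e - φ (e + 1)| := by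
              refine Finset.sum_le_sum fun e he ↦ ?_
              have he' := Finset.mem_Ioc.1 he
              rw [abs_mul]
              exact mul_le_mul_of_nonneg_right (hB e he'.1 he'.2) (abs_nonneg _)
          _ = B * ∑ e ∈ Ioc u w, |f e * h e - f (e + 1) * h (e + 1)| := by rw [← Finset.mul_sum]
          _ ≤ B * (F * (H + V)) :=
              mul_le_mul_of_nonneg_left (sum_abs_prod_sub_le_of_bv huw hf0 hfF hf hhH hV) hB0
    _ = B * (F * (2 * H + V)) := by ring

end Summit.Parity.GeneralizedHardyLittlewood.Theorems.MomentsBeyondDiagonal.DiagCorner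

end
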